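/-
COR-CM (cell pub-hodgecm2, stage 2 of the Hodge ladder) — count-neutral KERNEL COMBINATORICS «the index-two cyclic law» (modular ∪ semidihedral
columns), part IX: THE DICHOTOMY — the twist hypothesis `c ∈ ⟨u^{r+1}⟩` of part VI is EXACTLY `d₂ = 1`; otherwise `𝒦 = G`, `d₂ = 0`, `φ₂ = β − 2` and
`β − 2 ≤ μ ≤ β − 1` (seat prover-pub-hodgecm2-b23-g49-0, binder prover b23, gen 49; claim «INDEX-TWO CYCLIC LAW», HOME/INBOX.md l.22678; addendum to
the LANE RECORD l.22835).  Theorems only, on parts I, V, VI, VIII and the census seat lit-andre-3ʼs type-stabiliser subgroup / closed form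
(`mem_stabGen_of_notMem_zpowers`, `indexTwoRank_top`, `fibreTwo_add_two_eq_card_block_add_indexTwoRank`) and seat b09ʼs coinvariant floor BY NAME;
no `decide`, no certificate, no named fact, no `sorry`; `Interfaces.lean` (C1), every E term, B01, `Transposition/*`, `PortJoin/*`, `D2Bridge/*` untouched.
HONEST FRAMING: `HC_CM` is NOT proved, here or anywhere in the tree; nothing here is a period, a count of record or a headline.
T5: n/a-class (hypothesis binders = the fields of `IndexTwoCyclic.Datum`, `c·c = 1`, `c ≠ 1`, and `c ∉ ⟨u^{r+1}⟩` resp. `Even n` — inhabited by the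
dihedral data (`r = 2n − 1`: `u^{r+1} = 1`) resp. by part VIIʼs semidirect products; checker: self).
-/
import Summits.HodgeConjecture.CorCM.Census.IndexTwoCyclicLaw
import Summits.HodgeConjecture.CorCM.Census.IndexTwoCyclicBlockCount

/-!
# The index-two cyclic law, IX: the dichotomy `d₂ = 1 ⟺ c ∈ ⟨u^{r+1}⟩`

THE SETTING of parts I–VIII: an index-two cyclic datum `D` for `(G, c)` (`G ≅ ℤ/2n ⋊_r ℤ/2`, `c = uⁿ`, involution `w`, `w·u = uʳ·w`).

* §1 **If `c ∉ ⟨u^{r+1}⟩` then `𝒦(G, c) = G`** (`stabGen_eq_top_of_notMem`): `w ∈ 𝒦` always (`⟨w⟩ = {1, w}` misses `c`), and `c ∉ ⟨u·w⟩` because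
  `⟨u·w⟩ = ⟨u^{r+1}⟩ ⊔ ⟨u^{r+1}⟩·uw` meets `⟨u⟩` in `⟨u^{r+1}⟩` — so `u·w ∈ 𝒦`, `u = (u·w)·w ∈ 𝒦`.  Hence `d₂ = 0` and **`β = φ₂ + 2`**
  (`card_block_eq_fibreTwo_add_two_of_notMem`) — the dihedral column (`r = −1`, `u^{r+1} = 1`, seat b23 gen 48: `μ = β − 2`) and the mixed twists
  `r ≡ −1 (mod 2^{v₂(2n)})` (`D_{2^a·2} × ℤ/odd`, e.g. `G(24,7) = D₈ × ℤ/3`).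
* §2 **THE DICHOTOMY** (`indexTwoRank_stabGen_eq_one_iff`, `n` even): `d₂(G/𝒦) = 1 ↔ c ∈ ⟨u^{r+1}⟩`; and in the second case the census is pinned to a
  window of width one: **`β − 2 ≤ μ ≤ β − 1`** (`card_block_le_card_add_two_of_notMem` with part Vʼs `exists_gfaces_generate`) — the exact value for the
  mixed `d₂ = 0` twists other than the dihedral column is left open (numerically `β − 2`; the arc route of part V is one face short there).

## References
* [Pohlmann1968] H. Pohlmann, Algebraic cycles on abelian varieties of complex multiplication type, Ann. of Math. 88 (1968), Thm 1.
* [Milne1999] J. S. Milne, Lefschetz motives and the Tate conjecture, Compositio Math. 117 (1999), Prop. 2.1, p. 54.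
-/

namespace Summit.HodgeConjecture.CorCM.Census.IndexTwoCyclic

open Finset
open Summit.HodgeConjecture.CorCM.Prior.AllgGroup.RfwfAllgGroup
open Summit.HodgeConjecture.CorCM.Census.BlockParity
open Summit.HodgeConjecture.CorCM.Census.Coinvariant
open Summit.HodgeConjecture.CorCM.Census.TypeStabiliser
open Summit.HodgeConjecture.CorCM.Census.IndexTwo

noncomputable section

variable {G : Type*} [Group G] [Fintype G] [DecidableEq G] {c : G} {n : ℕ} [NeZero n]
variable (D : Datum G c n)

omit [DecidableEq G] in
include D in
/-- `c` is central along the datum (from `comm_pow_n`; file-local). [folklore] -/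
private theorem c_comm' (y : G) : y * c = c * y := by
  have h := D.comm_pow_n y
  rwa [D.hun] at h

omit [DecidableEq G] [NeZero n] in
include D in
/-- `|G|/2 = 2n` is even along the datum (file-local). [folklore] -/
private theorem even_card_div_two' : Even (Fintype.card G / 2) := by
  have h := (Subgroup.zpowers D.u).card_mul_index
  rw [Nat.card_zpowers, D.hord, D.hindex, Nat.card_eq_fintype_card] at h
  exact ⟨n, by omega⟩

/-! ## §1 `c ∉ ⟨u^{r+1}⟩` forces `𝒦 = G` -/

omit [Fintype G] [DecidableEq G] [NeZero n] in
/-- **`w ∈ 𝒦(G, c)`**: the involution `w` never carries `c` (`⟨w⟩ = {1, w}`, `c ∈ ⟨u⟩ ∖ {1}`). [folklore] -/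
theorem w_mem_stabGen (hc1 : c ≠ 1) : D.w ∈ stabGen c :=
  mem_stabGen_of_notMem_zpowers c (c_notMem_zpowers_of_involution D hc1 D.hw D.hww)

omit [Fintype G] [DecidableEq G] [NeZero n] in
/-- **If `c ∉ ⟨u^{r+1}⟩` then `c ∉ ⟨u·w⟩`**: an even power of `u·w` is a power of `(u·w)² = u^{r+1}`, an odd power lies outside `⟨u⟩`. [folklore] -/
theorem c_notMem_zpowers_u_mul_w (h : c ∉ Subgroup.zpowers (D.u ^ (D.r + 1))) : c ∉ Subgroup.zpowers (D.u * D.w) := by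
  intro hc
  obtain ⟨k, hk⟩ := Subgroup.mem_zpowers_iff.mp hc
  have hsq : (D.u * D.w) ^ 2 = D.u ^ (D.r + 1) := by
    have e := pow_mul_w_sq D 1
    rwa [pow_one, mul_one] at e
  rcases Int.even_or_odd' k with ⟨m, rfl | rfl⟩
  · -- `(uw)^(2m) = (u^{r+1})^m`
    apply h
    rw [Subgroup.mem_zpowers_iff]
    exact ⟨m, by rw [← hsq, ← zpow_natCast, ← zpow_mul, Nat.cast_ofNat]; exact hk⟩
  · -- `(uw)^(2m+1) = (u^{r+1})^m · u · w ∉ ⟨u⟩`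
    have e : (D.u * D.w) ^ (2 * m + 1) = (D.u ^ (D.r + 1)) ^ m * D.u * D.w := by
      rw [zpow_add, zpow_one, zpow_mul, zpow_ofNat, hsq, mul_assoc]
    rw [e] at hk
    have hmem : (D.u ^ (D.r + 1)) ^ m * D.u ∈ Subgroup.zpowers D.u :=
      Subgroup.mul_mem _ (Subgroup.zpow_mem _ (Subgroup.pow_mem _ (Subgroup.mem_zpowers _) _) m) (Subgroup.mem_zpowers _)
    have hcu : c ∈ Subgroup.zpowers D.u := by
      have h' := Subgroup.pow_mem (Subgroup.zpowers D.u) (Subgroup.mem_zpowers D.u) n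
      rwa [D.hun] at h'
    exact D.mul_w_notMem hmem (by rw [hk]; exact hcu)

omit [DecidableEq G] in
/-- **If `c ∉ ⟨u^{r+1}⟩` then `𝒦(G, c) = G`**: `w, u·w ∈ 𝒦`, so `u ∈ 𝒦`. [folklore] -/
theorem stabGen_eq_top_of_notMem (hc1 : c ≠ 1) (h : c ∉ Subgroup.zpowers (D.u ^ (D.r + 1))) : stabGen c = ⊤ := by
  have hw : D.w ∈ stabGen c := w_mem_stabGen D hc1
  have huw : D.u * D.w ∈ stabGen c := mem_stabGen_of_notMem_zpowers c (c_notMem_zpowers_u_mul_w D h)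
  have hu : D.u ∈ stabGen c := by
    have e : D.u = (D.u * D.w) * D.w := by rw [mul_assoc, D.hww, mul_one]
    rw [e]
    exact Subgroup.mul_mem _ huw hw
  rw [eq_top_iff]
  intro y _
  obtain ⟨i, -, rfl | rfl⟩ := D.exists_pow_or_pow_mul_w y
  · exact Subgroup.pow_mem _ hu i
  · exact Subgroup.mul_mem _ (Subgroup.pow_mem _ hu i) hw

omit [DecidableEq G] in
/-- … so `d₂(G/𝒦) = 0`. [folklore] -/
theorem indexTwoRank_stabGen_eq_zero_of_notMem (hc1 : c ≠ 1) (h : c ∉ Subgroup.zpowers (D.u ^ (D.r + 1))) :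
    indexTwoRank (stabGen c) = 0 := by
  rw [stabGen_eq_top_of_notMem D hc1 h]
  exact indexTwoRank_top

include D in
/-- **`β = φ₂ + 2` when `c ∉ ⟨u^{r+1}⟩`** (the dihedral column and the mixed `d₂ = 0` twists). [folklore] -/
theorem card_block_eq_fibreTwo_add_two_of_notMem (hc2 : c * c = 1) (hc1 : c ≠ 1) (h : c ∉ Subgroup.zpowers (D.u ^ (D.r + 1))) :
    Fintype.card (Block c) = fibreTwo c hc2 + 2 := by
  have hcf := fibreTwo_add_two_eq_card_block_add_indexTwoRank c hc2 hc1 (c_comm' D) (even_card_div_two' D)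
  rw [indexTwoRank_stabGen_eq_zero_of_notMem D hc1 h] at hcf
  omega

include D in
/-- **The census window when `c ∉ ⟨u^{r+1}⟩`**: every generating family of faces has at least `β − 2` members (and part V supplies one with at most
`β − 1`). [folklore] -/
theorem card_block_le_card_add_two_of_notMem (hc2 : c * c = 1) (hc1 : c ≠ 1) (h : c ∉ Subgroup.zpowers (D.u ^ (D.r + 1)))
    (S : Finset (CMF G c →₀ ℤ)) (hSF : (S : Set (CMF G c →₀ ℤ)) ⊆ gfaceSet G c hc2)
    (hgen : hodgeSpan c hc2 ≤ Submodule.span ℤ (pairSet c) ⊔ Submodule.span ℤ (translates c S)) :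
    Fintype.card (Block c) ≤ S.card + 2 := by
  have hle := fibreTwo_le_card c hc2 (c_comm' D) S (Submodule.span ℤ (pairSet c)) le_rfl
    (fun _ hy => gfaceSet_subset_hodgeSpan c hc2 (hSF hy)) (fun _ hy => hgen (gfaceSet_subset_hodgeSpan c hc2 hy))
  have h2 := card_block_eq_fibreTwo_add_two_of_notMem D hc2 hc1 h
  omega

include D in
/-- **`β − 2 ≤ μ ≤ β − 1` when `c ∉ ⟨u^{r+1}⟩`**, in `sInf` form: the least size of a generating face family lies in `{β − 2, β − 1}`. [folklore] -/
theorem exists_isLeast_of_notMem (hc2 : c * c = 1) (hc1 : c ≠ 1) (h : c ∉ Subgroup.zpowers (D.u ^ (D.r + 1))) :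
    ∃ m : ℕ, Fintype.card (Block c) ≤ m + 2 ∧ m + 1 ≤ Fintype.card (Block c) ∧
      IsLeast {m : ℕ | ∃ S : Finset (CMF G c →₀ ℤ), ↑S ⊆ gfaceSet G c hc2 ∧ S.card = m ∧
        hodgeSpan c hc2 ≤ Submodule.span ℤ (pairSet c) ⊔ Submodule.span ℤ (translates c S)} m := by
  classical
  set T := {m : ℕ | ∃ S : Finset (CMF G c →₀ ℤ), ↑S ⊆ gfaceSet G c hc2 ∧ S.card = m ∧
    hodgeSpan c hc2 ≤ Submodule.span ℤ (pairSet c) ⊔ Submodule.span ℤ (translates c S)} with hT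
  obtain ⟨S, hSF, hcard, hgen⟩ := exists_gfaces_generate D hc2
  have hne : T.Nonempty := ⟨S.card, S, hSF, rfl, hgen⟩
  have hleast : IsLeast T (sInf T) := Nat.sInf_mem hne |> fun hm => ⟨hm, fun k hk => Nat.sInf_le hk⟩
  refine ⟨sInf T, ?_, ?_, hleast⟩
  · obtain ⟨S₀, hS₀F, hS₀card, hS₀gen⟩ := hleast.1
    have := card_block_le_card_add_two_of_notMem D hc2 hc1 h S₀ hS₀F hS₀gen
    omega
  · have := hleast.2 ⟨S, hSF, rfl, hgen⟩
    omega

/-! ## §2 The dichotomy -/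

include D in
/-- **THE DICHOTOMY**: for an index-two cyclic datum of even level, `d₂(G/𝒦) = 1` iff `c ∈ ⟨u^{r+1}⟩` (and otherwise `d₂ = 0`). [folklore] -/
theorem indexTwoRank_stabGen_eq_one_iff (hc2 : c * c = 1) (hc1 : c ≠ 1) (hn : Even n) :
    indexTwoRank (stabGen c) = 1 ↔ c ∈ Subgroup.zpowers (D.u ^ (D.r + 1)) := by
  constructor
  · intro h1
    by_contra h
    have h0 := indexTwoRank_stabGen_eq_zero_of_notMem D hc1 h
    omega
  · intro h
    exact indexTwoRank_stabGen_eq_one_of_odd_coset D hc2 hc1 hn (odd_coset_of_mem_zpowers_twist D hc2 h)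

include D in
/-- **`φ₂` in closed form along the datum** (`n` even): `β = φ₂ + 1` if `c ∈ ⟨u^{r+1}⟩`, `β = φ₂ + 2` otherwise. [folklore] -/
theorem card_block_eq_fibreTwo_add (hc2 : c * c = 1) (hc1 : c ≠ 1) (hn : Even n) :
    Fintype.card (Block c) = fibreTwo c hc2 + (if c ∈ Subgroup.zpowers (D.u ^ (D.r + 1)) then 1 else 2) := by
  by_cases h : c ∈ Subgroup.zpowers (D.u ^ (D.r + 1))
  · rw [if_pos h]; exact card_block_eq_fibreTwo_add_one_of_twist D hc2 hc1 hn h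
  · rw [if_neg h]; exact card_block_eq_fibreTwo_add_two_of_notMem D hc2 hc1 h

end

end Summit.HodgeConjecture.CorCM.Census.IndexTwoCyclic
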